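import Literature.Analysis.FluidPDE.EyinkLocalFourFifths
import Literature.Analysis.FluidPDE.EyinkTransverseLimit
import Literature.Analysis.FluidPDE.DuchonRobertInviscidLimitProofs
import HarnessLib

/-!
# Eyink 2003, Theorem 1 (the mollified local 4/5- and 4/15-laws): discharge of the named fact

Topic: Analysis/FluidPDE, proofs. Sibling proof file of
`Literature.Analysis.FluidPDE.EyinkLocalFourFifths`, discharging its only named fact
`Torus.HasDuchonRobertDefect.eyinkApprox_tendsto` (G. L. Eyink, Nonlinearity 16 (2003) 137–145 =
arXiv:nlin/0208004, §2 **Theorem 1**): for `u ∈ L³([0,T] × T³)` a weak solution of incompressible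
Euler with Duchon–Robert defect `D` and `φ` a spherically symmetric mollifier, both of Eyink's
mollified fluxes converge to `D` in the sense of distributions,
`∫₀ᵀ∫ D_L^ε(u) ψ → D ψ` and `∫₀ᵀ∫ D_T^ε(u) ψ → D ψ` as `ε → 0⁺`.

## The proof (Eyink 2003, §2, as assembled in the tree)

Eyink's printed proof — the longitudinal/transverse mollified velocities `u_X^ε`, the scalar
pressures `p_X^ε = φ_X^ε * p` (with `φ_T(ℓ) = 2∫_ℓ^∞ φ(ℓ')/ℓ' dℓ'`, `φ_L = φ − φ_T`), the scale-`ε`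
balances (uuL-eq)/(uuT-eq), the strong limits `u_L^ε → u/3` (`L³`), `p_L^ε → p/3` (`L^{3/2}`, the
pressure `p = (−Δ)⁻¹∂ᵢ∂ⱼ(uᵢuⱼ) ∈ L^{3/2}` by Calderón–Zygmund) and Duchon–Robert's Prop. 2 — is
carried out in the tree, in every dimension `d ≥ 2` and *uniformly in the mollifier*, by the chain
`EyinkBalance` → `EyinkBalanceLimits` → `EyinkBalanceOfMatrix` → `EyinkTransverseLimit`
(`Torus.tendstoUniformlyOn_transverseApprox_of_matrix_facts`: the transverse half, `X = T`, for a
distributional Euler pair `(u,p)`, `u ∈ L³`, `p ∈ L^{3/2}`, with limit Duchon–Robert's energy flux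
functional `Torus.energyFluxFunctional T u p`), together with

* the `L^{3/2}` pressure of an `L³` weak Euler solution (`Torus.exists_pressure_of_fact'`, from
  the Calderón–Zygmund pressure fact `Torus.exists_pressure_of_tendsto_L3`, which the tree proves
  on every torus of dimension `≤ 3`, `Torus.exists_pressure_of_tendsto_L3_of_card_le_three`;
  Duchon–Robert 2000, Prop. 1);
* Duchon–Robert's Prop. 2 for `(u,p)`: the energy flux functional is a Duchon–Robert defect of `u`
  (`Torus.hasUniformDuchonRobertDefect_of_steps`, with `Torus.integral_kernelFlux_mul_eq_holds`,
  `Torus.symmTestField_identity_holds`), hence agrees with the given `D` on test functions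
  (`Torus.HasDuchonRobertDefect.unique`: "by the result of Duchon–Robert, that quantity in the
  brackets is equal to minus the defect distribution `D(u)`", Eyink 2003, end of the proof of
  Thm. 1).

This file adds the two remaining elementary steps of the printed statement and assembles:

* `Torus.integral_duchonRobertApprox_eq_eyinkApprox` — for a spherically symmetric unit-ball
  mollifier and `ε > 0`, at the level of `ψ`-pairings,
  `D_ε^φ(u) = d⁻¹ D_L^{ε,φ}(u) + ((d−1)/d) D_T^{ε,φ}(u)` — the integrated form of
  `u^ε = u_L^ε + u_T^ε`, `u_L^ε → u/3`, `u_T^ε → 2u/3` (Eyink 2003, proof of Thm. 1); with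
  Duchon–Robert's `D_ε^φ(u) → D` (the hypothesis `HasDuchonRobertDefect`) it turns the transverse
  limit into the longitudinal one;
* `Torus.exists_isRadialUnitBallMollifier_mollifierScale_eq` — a spherically symmetric mollifier
  with arbitrary compact support is a rescaled spherically symmetric *unit-ball* mollifier,
  `φ^ε = φ₁^{εR}`, and `D_X^{ε,φ} = D_X^{εR,φ₁}` (`…_congr_mollifierScale`), `ε ↦ εR` preserving
  `ε → 0⁺`;
* `Torus.HasDuchonRobertDefect.tendsto_eyinkApprox_of_pressure_fact` — **Theorem 1 in dimension
  `d ≥ 2` from the pressure fact alone**, and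
* `Torus.HasDuchonRobertDefect.eyinkApprox_tendsto_holds` — **the named fact (`d = 3`), proved
  unconditionally.**

## References

* G. L. Eyink, *Local 4/5-law and energy dissipation anomaly in turbulence*, Nonlinearity 16
  (2003) 137–145, doi:10.1088/0951-7715/16/1/309, arXiv:nlin/0208004 — §2 Thm. 1 and its proof
  ((moll-u-LT), (uuL-eq), (uuT-eq), (third-delta), (norm-uL-thirdu), (norm-pT-twothirdp),
  (L-conv)). [Eyink2003]
* J. Duchon, R. Robert, *Inertial energy dissipation for weak solutions of incompressible Euler
  and Navier–Stokes equations*, Nonlinearity 13 (2000) 249–255, Prop. 1, Prop. 2. [DuchonRobert2000]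
-/

noncomputable section

open MeasureTheory MeasureTheory.Measure TopologicalSpace Set Function Filter Metric Module
open _root_.Topology
open scoped InnerProductSpace RealInnerProductSpace ENNReal NNReal

namespace Literature.Analysis.FluidPDE.Torus

variable {d : Type*} [Fintype d]

/-! ## Rescaling a spherically symmetric mollifier to the unit ball -/

section Rescale

/-- **Every spherically symmetric mollifier is a rescaled spherically symmetric unit-ball
mollifier**: if `φ` is a radial mollifier, there are `R > 0` and a radial unit-ball mollifier `φ₁`
(namely `φ₁ = φ^{1/R} = R^d φ(R·)` for `supp φ ⊆ B_R`) with `φ^ε = φ₁^{εR}` for every `ε`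
(cf. `Torus.exists_isUnitBallMollifier_mollifierScale_eq`). [folklore] -/
theorem exists_isRadialUnitBallMollifier_mollifierScale_eq {φ : EuclideanSpace ℝ d → ℝ}
    (hφ : FluidPDE.IsMollifier φ) (hrad : ∀ x y : EuclideanSpace ℝ d, ‖x‖ = ‖y‖ → φ x = φ y) :
    ∃ R : ℝ, 0 < R ∧ ∃ φ₁ : EuclideanSpace ℝ d → ℝ, IsRadialUnitBallMollifier φ₁ ∧
      ∀ ε, FluidPDE.mollifierScale ε φ = FluidPDE.mollifierScale (ε * R) φ₁ := by
  obtain ⟨R₀, hR₀⟩ := hφ.2.1.isCompact.isBounded.subset_closedBall 0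
  set R : ℝ := max R₀ 1 with hRdef
  have hR : 0 < R := one_pos.trans_le (le_max_right _ _)
  have hsupp : ∀ ξ, R < ‖ξ‖ → φ ξ = 0 := fun ξ hξ => by
    by_contra h
    have : ξ ∈ closedBall (0 : EuclideanSpace ℝ d) R₀ := hR₀ (subset_tsupport _ (mem_support.2 h))
    rw [mem_closedBall, dist_zero_right] at this
    exact absurd (this.trans (le_max_left _ _)) (not_le.2 hξ)
  refine ⟨R, hR, FluidPDE.mollifierScale R⁻¹ φ,
    ⟨⟨hφ.mollifierScale (inv_pos.2 hR), fun ξ hξ => ?_⟩, fun x y hxy => ?_⟩,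
    fun ε => (mollifierScale_mollifierScale_inv hR.ne' ε).symm⟩
  · rw [FluidPDE.mollifierScale_apply, inv_inv, hsupp _ ?_, mul_zero]
    rw [norm_smul, Real.norm_eq_abs, abs_of_pos hR]
    calc R = R * 1 := (mul_one R).symm
      _ < R * ‖ξ‖ := by gcongr
  · rw [FluidPDE.mollifierScale_apply, FluidPDE.mollifierScale_apply,
      hrad (R⁻¹⁻¹ • x) (R⁻¹⁻¹ • y) (by rw [norm_smul, norm_smul, hxy])]

/-- Eyink's mollified longitudinal flux depends on `(φ, ε)` only through the rescaled kernel
`φ^ε`. [folklore] -/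
theorem eyinkLongitudinalApprox_congr_mollifierScale {φ φ' : EuclideanSpace ℝ d → ℝ} {ε ε' : ℝ}
    (h : FluidPDE.mollifierScale ε φ = FluidPDE.mollifierScale ε' φ')
    (w : UnitAddTorus d → EuclideanSpace ℝ d) (x : UnitAddTorus d) :
    eyinkLongitudinalApprox φ ε w x = eyinkLongitudinalApprox φ' ε' w x := by
  simp only [eyinkLongitudinalApprox, eyinkLongitudinalIntegrand, h]

/-- Eyink's mollified transverse flux depends on `(φ, ε)` only through the rescaled kernel `φ^ε`
(cf. `Torus.eyinkTransverseApprox_congr_kernel`). [folklore] -/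
theorem eyinkTransverseApprox_congr_mollifierScale {φ φ' : EuclideanSpace ℝ d → ℝ} {ε ε' : ℝ}
    (h : FluidPDE.mollifierScale ε φ = FluidPDE.mollifierScale ε' φ')
    (w : UnitAddTorus d → EuclideanSpace ℝ d) (x : UnitAddTorus d) :
    eyinkTransverseApprox φ ε w x = eyinkTransverseApprox φ' ε' w x := by
  simp only [eyinkTransverseApprox, eyinkTransverseIntegrand, h]

/-- `ε ↦ εR` maps `ε → 0⁺` to itself for `R > 0`. [folklore] -/
private theorem tendsto_mul_const_nhdsGT_zero {R : ℝ} (hR : 0 < R) :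
    Tendsto (fun ε : ℝ => ε * R) (𝓝[>] 0) (𝓝[>] 0) := by
  refine tendsto_nhdsWithin_iff.2 ⟨?_, ?_⟩
  · have h : Tendsto (fun ε : ℝ => ε * R) (𝓝 0) (𝓝 (0 * R)) :=
      ((continuous_id.mul continuous_const).tendsto (0 : ℝ))
    rw [zero_mul] at h
    exact h.mono_left nhdsWithin_le_nhds
  · filter_upwards [self_mem_nhdsWithin] with ε hε using mul_pos hε hR

end Rescale

/-! ## `D_ε^φ = d⁻¹ D_L^{ε,φ} + ((d−1)/d) D_T^{ε,φ}` on `ψ`-pairings -/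

section Split

variable {T : ℝ} {u : ℝ → UnitAddTorus d → EuclideanSpace ℝ d} {ψ : ℝ → UnitAddTorus d → ℝ} {Cψ : ℝ}

/-- **Duchon–Robert's pairing splits into Eyink's two** (`d ≥ 2`): for a spherically symmetric
unit-ball mollifier `φ` and `ε > 0`,
`∫₀ᵀ∫ D_ε^φ(u) ψ = d⁻¹ ∫₀ᵀ∫ D_L^{ε,φ}(u) ψ + ((d−1)/d) ∫₀ᵀ∫ D_T^{ε,φ}(u) ψ`, by the radial formulas
(`Torus.integral_duchonRobertApprox_eq_radial`: `¼|S|∫ x^dΦ' G(εx)`; `Torus.integral_eyinkApprox_eq`: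
`(d/4)|S|(∫ x^dΦ' G_L(εx) + J₂)`, `(d/(4(d−1)))|S|(∫ x^dΦ' G_T(εx) − J₂)`) and `G = G_L + G_T`
(`Torus.energyFluxShellPairing_eq_add`) — the integrated form of `u^ε = u_L^ε + u_T^ε`,
`u_L^ε → u/d`, `u_T^ε → (d−1)u/d`, i.e. of `(4/3) D_L^ε + (8/3) D_T^ε = 4 D_ε` in `d = 3` (Eyink 2003,
proof of Thm. 1; the same computation is inlined in
`Torus.HasUniformEyinkDefect.tendsto_duchonRobertApprox`). [cite: Eyink2003, §2 Thm. 1] -/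
theorem integral_duchonRobertApprox_eq_eyinkApprox [Nonempty d] (hn2 : 2 ≤ Fintype.card d)
    {φ : EuclideanSpace ℝ d → ℝ} (hφ : IsRadialUnitBallMollifier φ)
    (hu : AEStronglyMeasurable (uncurry u) ((volume.restrict (Ioo 0 T)).prod volume))
    (hu3 : ∫⁻ p, ‖uncurry u p‖ₑ ^ 3 ∂((volume.restrict (Ioo 0 T)).prod volume) < ∞)
    (hψm : AEStronglyMeasurable (uncurry ψ) ((volume.restrict (Ioo 0 T)).prod volume))
    (hψb : ∀ t x, |ψ t x| ≤ Cψ) {ε : ℝ} (hε : 0 < ε) :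
    ∫ t in Ioo 0 T, ∫ x, duchonRobertApprox φ ε (u t) x * ψ t x =
      (Fintype.card d : ℝ)⁻¹ * (∫ t in Ioo 0 T, ∫ x, eyinkLongitudinalApprox φ ε (u t) x * ψ t x) +
        ((Fintype.card d : ℝ) - 1) / Fintype.card d *
          (∫ t in Ioo 0 T, ∫ x, eyinkTransverseApprox φ ε (u t) x * ψ t x) := by
  obtain ⟨m, hnm⟩ : ∃ m : ℕ, Fintype.card d = m + 2 := ⟨Fintype.card d - 2, by omega⟩
  set n : ℕ := Fintype.card d with hndef
  have hnR : (n : ℝ) = (m : ℝ) + 2 := by rw [hnm]; push_cast; ring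
  set c : ℝ := (volume : Measure (EuclideanSpace ℝ d)).toSphere.real univ with hcdef
  have hc : 0 < c := toSphere_real_univ_pos
  obtain ⟨e₀, he₀⟩ : ∃ e : EuclideanSpace ℝ d, ‖e‖ = 1 := by
    classical
    obtain ⟨i⟩ := ‹Nonempty d›
    exact ⟨EuclideanSpace.single i 1, by simp⟩
  -- the two shell pairings and shell functions
  set IL : ℝ → ℝ := cubicShellPairing (fun (ω v : EuclideanSpace ℝ d) => ⟪v, ω⟫ ^ 3) T u ψ with hILdef
  set IT : ℝ → ℝ := cubicShellPairing
    (fun (ω v : EuclideanSpace ℝ d) => ⟪v, ω⟫ * ‖v - ⟪v, ω⟫ • ω‖ ^ 2) T u ψ with hITdef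
  have hILc : Continuous IL := continuous_cubicShellPairing_L hu hu3 hψm hψb
  have hITc : Continuous IT := continuous_cubicShellPairing_T hu hu3 hψm hψb
  set gL : ℝ → ℝ := fun r => r⁻¹ * IL r with hgLdef
  set gT : ℝ → ℝ := fun r => r⁻¹ * IT r with hgTdef
  -- the profile of `φ`
  set Φ : ℝ → ℝ := fun r => φ (r • e₀) with hΦ
  have hΦ1 : ContDiff ℝ 1 Φ := (hφ.1.1.1.of_le (by simp)).comp (contDiff_id.smul contDiff_const)
  have hΦsupp : ∀ r, 1 < r → Φ r = 0 := fun r hr =>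
    hφ.1.2 _ (by rw [norm_smul, he₀, mul_one, Real.norm_eq_abs]; exact hr.trans_le (le_abs_self r))
  have hΦ'supp : ∀ r, 1 < r → deriv Φ r = 0 := fun r hr => deriv_eq_zero_of_forall_gt hΦsupp hr
  have hΦ'c : Continuous (deriv Φ) := hΦ1.continuous_deriv le_rfl
  -- the three radial formulas
  have e1 : ∫ t in Ioo 0 T, ∫ x, duchonRobertApprox φ ε (u t) x * ψ t x =
      4⁻¹ * c * ∫ x in Ioi (0 : ℝ), x ^ n * deriv Φ x *
        ((ε * x)⁻¹ * energyFluxShellPairing T u ψ (ε * x)) :=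
    integral_duchonRobertApprox_eq_radial (T := T) (u := u) (ψ := ψ) hφ.1 hφ.2 he₀ hu hu3 hψm hψb hε
  have e2 := integral_eyinkApprox_eq (T := T) (u := u) (ψ := ψ) hn2 hφ.1.1 hφ.2 hφ.1.2 he₀ hu hu3
    hψm hψb hε
  have e2L : ∫ t in Ioo 0 T, ∫ x, eyinkLongitudinalApprox φ ε (u t) x * ψ t x =
      eyinkLongitudinalConst d * c *
        ((∫ x in Ioi (0 : ℝ), x ^ n * deriv Φ x * gL (ε * x)) +
          ∫ x in Ioi (0 : ℝ), 2 * x ^ (n - 1) * Φ x * gT (ε * x)) := e2.1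
  have e2T : ∫ t in Ioo 0 T, ∫ x, eyinkTransverseApprox φ ε (u t) x * ψ t x =
      eyinkTransverseConst d * c *
        ((∫ x in Ioi (0 : ℝ), x ^ n * deriv Φ x * gT (ε * x)) -
          ∫ x in Ioi (0 : ℝ), 2 * x ^ (n - 1) * Φ x * gT (ε * x)) := e2.2
  -- the Duchon–Robert integrand splits
  have hsum : ∀ x : ℝ, (ε * x)⁻¹ * energyFluxShellPairing T u ψ (ε * x) = gL (ε * x) + gT (ε * x) := by
    intro x
    simp only [hgLdef, hgTdef, hILdef, hITdef]
    rw [energyFluxShellPairing_eq_add hu hu3 hψm hψb, mul_add]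
  have hintL : IntegrableOn (fun x : ℝ => x ^ n * deriv Φ x * gL (ε * x)) (Ioi 0) := by
    have := integrableOn_pow_mul_mul_shellFunction hΦ'c hΦ'supp hILc (m + 1) hε
    rw [← hnm] at this
    exact this
  have hintT : IntegrableOn (fun x : ℝ => x ^ n * deriv Φ x * gT (ε * x)) (Ioi 0) := by
    have := integrableOn_pow_mul_mul_shellFunction hΦ'c hΦ'supp hITc (m + 1) hε
    rw [← hnm] at this
    exact this
  have hsplit : ∫ x in Ioi (0 : ℝ), x ^ n * deriv Φ x * ((ε * x)⁻¹ * energyFluxShellPairing T u ψ (ε * x)) =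
      (∫ x in Ioi (0 : ℝ), x ^ n * deriv Φ x * gL (ε * x)) +
        ∫ x in Ioi (0 : ℝ), x ^ n * deriv Φ x * gT (ε * x) := by
    rw [← integral_add hintL hintT]
    refine setIntegral_congr_fun measurableSet_Ioi fun x _ => ?_
    rw [hsum x, mul_add]
  rw [e1, e2L, e2T, hsplit]
  simp only [eyinkLongitudinalConst, eyinkTransverseConst, ← hndef]
  have hm1 : (n : ℝ) - 1 ≠ 0 := by rw [hnR]; have : (0:ℝ) ≤ m := Nat.cast_nonneg m; linarith
  have hn0 : (n : ℝ) ≠ 0 := by rw [hnR]; have : (0:ℝ) ≤ m := Nat.cast_nonneg m; linarith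
  field_simp
  ring

end Split

/-! ## Theorem 1 -/

section TheoremOne

variable {T : ℝ} {u : ℝ → UnitAddTorus d → EuclideanSpace ℝ d} {D : STFunctional d}

/-- **Eyink 2003, Theorem 1, in dimension `d ≥ 2`, from the pressure fact alone.** Let `u ∈ L³` be a
weak Euler solution on `T^d × (0,T)` with Duchon–Robert defect `D`, and grant the `L^{3/2}`-pressure
fact `Torus.exists_pressure_of_tendsto_L3` (proved in the tree for `card d ≤ 3`). Then for every
spherically symmetric mollifier `φ` and every test function `ψ` supported in `(0,T)`,
`∫₀ᵀ∫ D_L^{ε,φ}(u) ψ → D ψ` and `∫₀ᵀ∫ D_T^{ε,φ}(u) ψ → D ψ` as `ε → 0⁺`. Proof: with the pressure `p`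
(`exists_pressure_of_fact'`), the energy flux functional `D(u,p)` is a Duchon–Robert defect of `u`
(`hasUniformDuchonRobertDefect_of_steps`), hence `D ψ = D(u,p)(ψ)` (`HasDuchonRobertDefect.unique`);
for the rescaled unit-ball profile `φ₁` (`φ^ε = φ₁^{εR}`) the transverse pairing tends to `D(u,p)(ψ)`
(`tendstoUniformlyOn_transverseApprox_of_matrix_facts`, pointwise in `φ₁`), the longitudinal one
then by `D_ε^{φ₁} = d⁻¹D_L + ((d−1)/d)D_T` and `∫∫ D_ε^{φ₁} ψ → D ψ`; finally `ε ↦ εR`. [cite: Eyink2003, §2 Thm. 1] -/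
theorem HasDuchonRobertDefect.tendsto_eyinkApprox_of_pressure_fact [DecidableEq d]
    (hd : 2 ≤ Fintype.card d) (hA1 : exists_pressure_of_tendsto_L3 (T := T) (u := u))
    (h : HasDuchonRobertDefect T u D) (hE : FunctionSpaces.Torus.IsWeakEulerSolutionOn T u)
    (hu3 : ∫⁻ t in Ioo 0 T, ∫⁻ x, ‖u t x‖ₑ ^ (3 : ℕ) < ∞)
    {φ : EuclideanSpace ℝ d → ℝ} (hφ : FluidPDE.IsMollifier φ)
    (hrad : ∀ ξ η : EuclideanSpace ℝ d, ‖ξ‖ = ‖η‖ → φ ξ = φ η)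
    {ψ : ℝ → UnitAddTorus d → ℝ} (hψ : FunctionSpaces.Torus.IsSpaceTimeTestIoo T ψ) :
    Tendsto (fun ε => ∫ t in Ioo 0 T, ∫ x, eyinkLongitudinalApprox φ ε (u t) x * ψ t x)
        (𝓝[>] 0) (𝓝 (D ψ)) ∧
      Tendsto (fun ε => ∫ t in Ioo 0 T, ∫ x, eyinkTransverseApprox φ ε (u t) x * ψ t x)
        (𝓝[>] 0) (𝓝 (D ψ)) := by
  haveI : Nonempty d := Fintype.card_pos_iff.1 (by omega)
  -- the pressure
  obtain ⟨p, hsol, hp32⟩ := exists_pressure_of_fact' hA1 hE hu3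
  -- the energy flux functional is a Duchon–Robert defect, hence agrees with `D` on `ψ`
  have hJ : HasDuchonRobertDefect T u (energyFluxFunctional T u p) :=
    (hasUniformDuchonRobertDefect_of_steps integral_kernelFlux_mul_eq_holds symmTestField_identity_holds
      hsol hu3 hp32).hasDuchonRobertDefect
  have hDJ : D ψ = energyFluxFunctional T u p ψ := h.unique hJ hψ
  -- the uniform transverse limit
  have hTU := tendstoUniformlyOn_transverseApprox_of_matrix_facts hd integral_matKernelFlux_mul_eq_holds
    IsDistributionalNSSolutionOn.matSymmTestField_identity_holds hsol hu3 hp32 hψ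
  -- rescale `φ` to a radial unit-ball mollifier `φ₁`, `φ^ε = φ₁^{εR}`
  obtain ⟨R, hR, φ₁, hφ₁, hscale⟩ := exists_isRadialUnitBallMollifier_mollifierScale_eq hφ hrad
  -- product-measure data for the pairing identity
  have hu : AEStronglyMeasurable (uncurry u) ((volume.restrict (Ioo 0 T)).prod volume) :=
    aestronglyMeasurable_uncurry_prod_of_stLift_Ioo hE.1
  have hu3' := lintegral_prod_enorm_pow_three_lt_top hu hu3
  have hψm : AEStronglyMeasurable (uncurry ψ) ((volume.restrict (Ioo 0 T)).prod volume) :=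
    hψ.continuous_uncurry.aestronglyMeasurable
  obtain ⟨Cψ, hψb⟩ := hψ.exists_abs_le
  -- the two limits for `φ₁`
  have hT1 : Tendsto (fun ε => ∫ t in Ioo 0 T, ∫ x, eyinkTransverseApprox φ₁ ε (u t) x * ψ t x)
      (𝓝[>] 0) (𝓝 (D ψ)) := by
    rw [hDJ]
    exact hTU.tendsto_at hφ₁
  have hDR1 : Tendsto (fun ε => ∫ t in Ioo 0 T, ∫ x, duchonRobertApprox φ₁ ε (u t) x * ψ t x)
      (𝓝[>] 0) (𝓝 (D ψ)) := h φ₁ hφ₁.1.1 ψ hψ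
  have hL1 : Tendsto (fun ε => ∫ t in Ioo 0 T, ∫ x, eyinkLongitudinalApprox φ₁ ε (u t) x * ψ t x)
      (𝓝[>] 0) (𝓝 (D ψ)) := by
    set n : ℕ := Fintype.card d with hndef
    have hn0 : (n : ℝ) ≠ 0 := by exact_mod_cast (show n ≠ 0 by omega)
    have hlim := (hDR1.const_mul (n : ℝ)).sub (hT1.const_mul ((n : ℝ) - 1))
    have hval : (n : ℝ) * D ψ - ((n : ℝ) - 1) * D ψ = D ψ := by ring
    rw [hval] at hlim
    refine hlim.congr' ?_
    filter_upwards [self_mem_nhdsWithin] with ε hε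
    rw [integral_duchonRobertApprox_eq_eyinkApprox hd hφ₁ hu hu3' hψm hψb hε, ← hndef]
    field_simp
    ring
  -- transfer to `φ` along `ε ↦ εR`
  have hcomp := tendsto_mul_const_nhdsGT_zero hR
  refine ⟨(hL1.comp hcomp).congr fun ε => ?_, (hT1.comp hcomp).congr fun ε => ?_⟩
  · show (∫ t in Ioo 0 T, ∫ x, eyinkLongitudinalApprox φ₁ (ε * R) (u t) x * ψ t x) =
      ∫ t in Ioo 0 T, ∫ x, eyinkLongitudinalApprox φ ε (u t) x * ψ t x
    simp only [eyinkLongitudinalApprox_congr_mollifierScale (hscale ε)]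
  · show (∫ t in Ioo 0 T, ∫ x, eyinkTransverseApprox φ₁ (ε * R) (u t) x * ψ t x) =
      ∫ t in Ioo 0 T, ∫ x, eyinkTransverseApprox φ ε (u t) x * ψ t x
    simp only [eyinkTransverseApprox_congr_mollifierScale (hscale ε)]

/-- **Eyink 2003, Theorem 1 (the mollified local 4/5- and 4/15-laws), proved**: the discharge of the
named fact `Torus.HasDuchonRobertDefect.eyinkApprox_tendsto` — for every weak Euler solution
`u ∈ L³([0,T] × T³)` with Duchon–Robert defect `D`, every spherically symmetric mollifier `φ` and
every test function `ψ` supported in `(0,T) × T³`, `∫₀ᵀ∫ D_L^ε(u) ψ → D ψ` and `∫₀ᵀ∫ D_T^ε(u) ψ → D ψ`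
as `ε → 0⁺` (`tendsto_eyinkApprox_of_pressure_fact` in `d = 3`, where the Calderón–Zygmund pressure
fact is proved, `Torus.exists_pressure_of_tendsto_L3_of_card_le_three`). [cite: Eyink2003, §2 Thm. 1] -/
theorem HasDuchonRobertDefect.eyinkApprox_tendsto_holds : HasDuchonRobertDefect.eyinkApprox_tendsto := by
  intro T u D h hE hu3 φ hφ hrad ψ hψ
  exact h.tendsto_eyinkApprox_of_pressure_fact (by simp)
    (exists_pressure_of_tendsto_L3_of_card_le_three (by simp)) hE hu3 hφ hrad hψ

end TheoremOne

end Literature.Analysis.FluidPDE.Torus
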